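import Summits.PneNP.PneNP.Theorems.ChebyshevTracialDesignJuntaRemainderPricing
import Summits.PneNP.PneNP.Theorems.ChebyshevTracialDesignCutJuntaMasks
import Literature.Combinatorics.Optimization.TracialDesignsLowDegreeProofs
import HarnessLib

/-!
# Cell pnp-psdrank, route `ChebyshevTracialDesign`: THE TILTED JUNTA PROFILE — for a nonnegative `J`-junta mask `f` and ANY direction `v`, the level
# profile of `f·C_v²` at a matching is ONE polynomial of degree `≤ |J|+2` that has NONNEGATIVE VIRTUAL VALUE (sum of squares, Grigoriev) AND is SMOOTH
# (`|P^{(m)}| ≤ ‖v‖₁²Λ_f·4^{|J|+2}·C(|J|+2,m)m!N^{|J|+2−m}/[N]_{|J|+2}` on `[0,N]`, pattern by pattern) (crux `TracialDecayExp20`, stmt-PneNP-19878)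

Brick 113a (prover g20; MEMO-23 §2(d)/§5 prover (2), settled). The (CG_1') form `Q^f_M(v) = Σ_U W(U,M)·f(U)·C_v(U)²`, `C_v(U) = Σ_p v_p x_px_{π_Mp}`, is the
design applied at `M` to the cut statistic `g = f·C_v²`. Two descriptions of the level profile of `g` at `M`:
(A) SMOOTH: `g = Σ_{p,q} v_pv_q·(f·x_px_{πp}x_qx_{πq})`, each term a NONNEGATIVE junta on a window of `≤ |J|+2` edges, so by brick 110b
    (`junta_sum_law_smooth`) its level sums are `T(N;c,i)·P_{pq}(c)` with `|P_{pq}^{(m)}| ≤ Λ_f·4^{|J|+2}·C(|J|+2,m)m!N^{|J|+2−m}/[N]_{|J|+2}` on `[0,N]`;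
    `P̃ = Σ v_pv_qP_{pq}` inherits the bound times `(Σ_p|v_p|)²` — the SIGNS of `v_pv_q` are irrelevant for a termwise absolute bound.
(B) POSITIVE AT THE VIRTUAL LEVEL: `f = Σ_l g_l²` with `deg g_l ≤ |J|` (brick 109 `exists_sos_of_nonneg_junta`), `C_v` has Johnson degree `2`
    (brick 103), so `g = Σ_l (g_lC_v)²` is a sum of squares of degree `≤ |J|+2` and the sharp half-degree law (Literature `lowdeg_sum_law_sharp`,
    Grigoriev's knapsack positivity, range `2(|J|+2)+1 ≤ t`) gives level sums `T(N;c,i)·P♯(c)` with `deg P♯ ≤ |J|+2` and `P♯(0) ≥ 0`.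
(C) `P̃ = P♯` (`levelLaw_unique`: both have degree `≤ |J|+2 < (t+1)/2` and agree at the `(t+1)/2` odd levels, where `T(N;c,i) > 0`).
THEOREMS: **`levelLaw_unique`**, **`tiltedJunta_levelLaw`** (`∃ P`, `deg P ≤ |J|+2`, `P(0) ≥ 0`, the level-sum identity for `[U odd]·f(U)C_v(U)²` in the
crossing/internal-count form of the junta files, and the derivative bounds on `[0, N]`). Consequence (brick 113b `…JuntaContainmentAllDirections`):
`Q^f_M(v) ≤ |PM|⁻¹·B_v·C(T,D+1)·‖v‖₁²Λ_f·4^{|J|+2}C(|J|+2,D+1)(D+1)!N^{|J|+1−D}/[N]_{|J|+2}` for EVERY direction `v`, and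
`Σ_M sup_{v_M ∈ [−1,1]^n}(Q^f_M(v_M))₊ ≤ B_v·C(T,D+1)·n²Λ_f·8^{|J|+2}C(|J|+2,D+1)(D+1)!/N^{D+1}`: FULL (CG_1') for nonnegative junta masks of size `O(D)`.
[cite: Grigoriev2001, Lemma 1.4 (PDF p. 8)] [cite: Rothvoss2017, §2 (PDF p. 6)] [cite: SakaueEtAl2017, main theorem (as quoted in KurpiszLeppanenMastrolilli2016 §1 p. 3)]
[cite: Agarwal2000DifferenceEquations, Remark 1.8.1 (1.8.8)]
Stature: support/instrument (kernel lane, no defs, axioms standard). WHAT THIS IS NOT: nothing on NON-junta masks (the open part of (CG_1')), no proof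
or refutation of `TracialDecayExp20`, nothing on psd rank of P_PM(K_n), no P-vs-NP content. Supports stmt-PneNP-19878.
-/

set_option linter.dupNamespace false -- `Summit.PneNP.PneNP.…`: summit = sub-problem (D-0017)

noncomputable section

namespace Summit.PneNP.PneNP.Theorems.ChebyshevTracialDesignJuntaTiltedProfile

open Finset Matrix Polynomial Literature.Barriers.PneNP Literature.Combinatorics.Optimization
open Literature.Computability.Complexity (Grigoriev2001_knapsackFormNonneg_holds)
open Literature.Combinatorics.Optimization.ChebyshevTracialDesignJunta (lowdeg_sum_law_sharp)
open Summit.PneNP.PneNP.Theorems.ChebyshevTracialDesignJunta (card_eq_cr_add_two_mul_in card_filter_cr_in_eq two_mul_card_pmatch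
  card_window_edges_le subset_verts_window)
open Summit.PneNP.PneNP.Theorems.ChebyshevTracialDesignJuntaRemainderPricing (junta_sum_law_smooth card_window_le)
open Summit.PneNP.PneNP.Theorems.ChebyshevTracialDesignCutJuntaMasks (exists_sos_of_nonneg_junta)
open Summit.PneNP.PneNP.Theorems.ChebyshevTracialDesignPairContainmentCells (containment_mem_lowSpan)
open Summit.PneNP.PneNP.Theorems.ChebyshevTracialDesignLowDegreeMasks (mul_mem_lowSpan)

variable {n : ℕ}

/-! ### §1 Level laws are unique below degree `(t+1)/2` -/

/-- **A level law determines its polynomial.** If two real polynomials of degree `≤ k` reproduce the same level sums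
`S(c,i) = T(N; c, i)·P(c)` along `c + 2i = t` (`T(N;c,i) = C(N,c+i)C(c+i,i)2^c`), with `t` odd, `t ≤ N` and `2k + 1 ≤ t`, they are equal (they agree at
the `(t+1)/2 > k` odd levels, where `T(N;c,i) > 0`). [folklore] -/
theorem levelLaw_unique {N t k : ℕ} (ht : Odd t) (htN : t ≤ N) (hk : 2 * k + 1 ≤ t) (S : ℕ → ℕ → ℝ) {P Q : Polynomial ℝ}
    (hPdeg : P.natDegree ≤ k) (hQdeg : Q.natDegree ≤ k)
    (hP : ∀ c i : ℕ, c + 2 * i = t → S c i = ((N.choose (c + i) * (c + i).choose i * 2 ^ c : ℕ) : ℝ) * P.eval (c : ℝ))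
    (hQ : ∀ c i : ℕ, c + 2 * i = t → S c i = ((N.choose (c + i) * (c + i).choose i * 2 ^ c : ℕ) : ℝ) * Q.eval (c : ℝ)) :
    P = Q := by
  obtain ⟨c', hc'⟩ := ht
  refine eq_of_natDegree_lt_card_of_eval_eq P Q (ι := Fin (c' + 1)) (f := fun j => (((2 * (j : ℕ) + 1 : ℕ)) : ℝ)) ?_ ?_ ?_
  · intro a b hab
    have h0 : (((2 * (a : ℕ) + 1 : ℕ)) : ℝ) = (((2 * (b : ℕ) + 1 : ℕ)) : ℝ) := hab
    have h : (2 * (a : ℕ) + 1 : ℕ) = 2 * (b : ℕ) + 1 := by exact_mod_cast h0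
    exact Fin.ext (by omega)
  · intro j
    have hj : (j : ℕ) ≤ c' := Nat.lt_succ_iff.1 j.2
    have hci : (2 * (j : ℕ) + 1) + 2 * (c' - j) = t := by omega
    have h1 := hP _ _ hci
    have h2 := hQ _ _ hci
    rw [h1] at h2
    have hT : (((N.choose (2 * (j : ℕ) + 1 + (c' - j)) * (2 * (j : ℕ) + 1 + (c' - j)).choose (c' - j) *
        2 ^ (2 * (j : ℕ) + 1) : ℕ)) : ℝ) ≠ 0 := by
      have ha : 0 < N.choose (2 * (j : ℕ) + 1 + (c' - j)) := Nat.choose_pos (by omega)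
      have hb : 0 < (2 * (j : ℕ) + 1 + (c' - j)).choose (c' - j) := Nat.choose_pos (by omega)
      positivity
    exact mul_left_cancel₀ hT h2
  · simp only [Fintype.card_fin]
    exact max_lt (by omega) (by omega)

/-! ### §2 The tilted junta profile `f·C_v²`: smooth, and with nonnegative virtual value -/

/-- **THE LEVEL PROFILE OF `f·C_v²` AT A MATCHING** (`f` a nonnegative `J`-junta, `v` ANY direction in the cube, `C_v(U) = Σ_p v_p x_p x_{π_M p}`):
for odd `t` with `2(|J|+2)+1 ≤ t`, `2t+2 ≤ n`, there is ONE real polynomial `P` of degree `≤ |J| + 2` with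
(i) level sums: `Σ_{U : cr = c, in = i} [U odd]·f(U)C_v(U)² = T(N;c,i)·P(c)` along `c + 2i = t` (`N = n/2`);
(ii) NONNEGATIVE VIRTUAL VALUE `P(0) ≥ 0` — `f = Σ_l g_l²` with `deg g_l ≤ |J|` (brick 109), so `f·C_v² = Σ_l (g_lC_v)²` is a sum of squares of Johnson
degree `≤ |J|+2` and the sharp half-degree law (Literature `lowdeg_sum_law_sharp`, Grigoriev's knapsack positivity) applies;
(iii) SMOOTHNESS `|P^{(m)}(ξ)| ≤ (Σ_p|v_p|)²·Λ_f·4^{|J|+2}·C(|J|+2,m)·m!·N^{|J|+2−m}/[N]_{|J|+2}` on `[0,N]` — `f·C_v² = Σ_{p,q} v_pv_q·(f·x_px_{πp}x_qx_{πq})`, each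
term a nonnegative junta on a window of `≤ |J|+2` edges (brick 110b `junta_sum_law_smooth`), signed coefficients bounded termwise.
(ii) and (iii) concern the SAME polynomial by `levelLaw_unique`. [cite: Grigoriev2001, Lemma 1.4 (PDF p. 8)] [cite: Rothvoss2017, §2 (PDF p. 6)]
[cite: SakaueEtAl2017, main theorem (as quoted in KurpiszLeppanenMastrolilli2016 §1 p. 3)] -/
theorem tiltedJunta_levelLaw (M : PMatch n) {t : ℕ} (ht : Odd t) (htn : 2 * t + 2 ≤ n) (J : Finset (Fin n)) (hJt : 2 * (J.card + 2) + 1 ≤ t)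
    (f : OddSet n → ℝ) (hf : ∀ U U' : OddSet n, U.1 ∩ J = U'.1 ∩ J → f U = f U') {Λf : ℝ} (hf0 : ∀ U, 0 ≤ f U) (hfΛ : ∀ U, f U ≤ Λf)
    (v : Fin n → ℝ) :
    ∃ P : Polynomial ℝ, P.natDegree ≤ J.card + 2 ∧ 0 ≤ P.eval 0 ∧
      (∀ c i : ℕ, c + 2 * i = t →
        ∑ U ∈ (univ : Finset (Fin n)).powerset.filter (fun U =>
            (M.1.filter fun e => cutCount U e = 1).card = c ∧ (M.1.filter fun e => cutCount U e = 2).card = i),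
          (if h : Odd U.card then f ⟨U, h⟩ * (∑ p, v p * ((if p ∈ U then (1 : ℝ) else 0) * (if M.2.partner p ∈ U then (1 : ℝ) else 0))) ^ 2
            else 0) =
          (((n / 2).choose (c + i) * (c + i).choose i * 2 ^ c : ℕ) : ℝ) * P.eval (c : ℝ)) ∧
      ∀ (m : ℕ) (ξ : ℝ), 0 ≤ ξ → ξ ≤ ((n / 2 : ℕ) : ℝ) →
        |(derivative^[m] P).eval ξ| ≤ (∑ p, |v p|) ^ 2 * Λf * (4 : ℝ) ^ (J.card + 2) *
          ((((J.card + 2).choose m : ℕ) : ℝ) * (m.factorial : ℝ) * (((n / 2 : ℕ) : ℝ)) ^ (J.card + 2 - m) /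
            ((n / 2).descFactorial (J.card + 2) : ℝ)) := by
  classical
  set k := J.card + 2 with hk
  set N := n / 2 with hNdef
  have hN : M.1.card = N := by have := two_mul_card_pmatch M; omega
  have htN : t ≤ N := by omega
  -- nonemptiness of `OddSet n`, hence `0 ≤ Λf`
  have hΛf : 0 ≤ Λf := by
    have hodd1 : Odd (({(⟨0, by omega⟩ : Fin n)} : Finset (Fin n)).card) := by simp
    exact (hf0 ⟨_, hodd1⟩).trans (hfΛ ⟨_, hodd1⟩)
  -- abbreviations
  set xx : Finset (Fin n) → Fin n → ℝ := fun U p => (if p ∈ U then (1 : ℝ) else 0) * (if M.2.partner p ∈ U then (1 : ℝ) else 0) with hxx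
  set Cv : Finset (Fin n) → ℝ := fun U => ∑ p, v p * xx U p with hCv
  set G : Finset (Fin n) → ℝ := fun U => if h : Odd U.card then f ⟨U, h⟩ * Cv U ^ 2 else 0 with hG
  set Gpq : Fin n → Fin n → Finset (Fin n) → ℝ := fun p q U => if h : Odd U.card then f ⟨U, h⟩ * (xx U p * xx U q) else 0 with hGpq
  have hGsum : ∀ U, G U = ∑ p, ∑ q, v p * v q * Gpq p q U := by
    intro U
    rw [hG, hGpq]; dsimp only
    split_ifs with h
    · rw [hCv]; dsimp only
      rw [sq, sum_mul_sum, mul_sum]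
      refine sum_congr rfl fun p _ => ?_
      rw [mul_sum]
      exact sum_congr rfl fun q _ => by ring
    · simp
  -- STEP A: the smooth profile from the pattern expansion
  have hpat : ∀ p q : Fin n, ∃ P : Polynomial ℝ, P.natDegree ≤ k ∧ (∀ c i : ℕ, c + 2 * i = t →
      ∑ U ∈ (univ : Finset (Fin n)).powerset.filter (fun U =>
          (M.1.filter fun e => cutCount U e = 1).card = c ∧ (M.1.filter fun e => cutCount U e = 2).card = i), Gpq p q U =
        ((N.choose (c + i) * (c + i).choose i * 2 ^ c : ℕ) : ℝ) * P.eval (c : ℝ)) ∧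
      ∀ (m : ℕ) (ξ : ℝ), 0 ≤ ξ → ξ ≤ (N : ℝ) →
        |(derivative^[m] P).eval ξ| ≤ Λf * (4 : ℝ) ^ k *
          (((k.choose m : ℕ) : ℝ) * (m.factorial : ℝ) * (N : ℝ) ^ (k - m) / (N.descFactorial k : ℝ)) := by
    intro p q
    set A : Finset (Fin n) := J ∪ {p, q} with hA
    have hAcard : A.card ≤ k := by
      rw [hA, hk]; exact (card_union_le _ _).trans (by have := Finset.card_le_two (a := p) (b := q); omega)
    set E₀ := M.1.filter (fun e => ∃ a ∈ A, a ∈ e) with hE₀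
    have hE₀M : E₀ ⊆ M.1 := filter_subset _ _
    have hE₀A : E₀.card ≤ k := (card_window_edges_le M A).trans hAcard
    obtain ⟨E, hE₀E, hEM, hEcard⟩ := exists_subsuperset_card_eq hE₀M hE₀A (by rw [hN]; omega)
    set W := (univ : Finset (Fin n)).filter (fun w => ∃ e ∈ E, w ∈ e) with hW
    have hAW : A ⊆ W := by
      intro a ha
      obtain ⟨e, he, hae⟩ := (mem_filter.1 (subset_verts_window M A ha)).2
      exact mem_filter.2 ⟨mem_univ a, e, hE₀E he, hae⟩
    have hJW : J ⊆ W := fun a ha => hAW (by rw [hA]; exact mem_union_left _ ha)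
    have hpW : p ∈ W := hAW (by rw [hA]; simp)
    have hqW : q ∈ W := hAW (by rw [hA]; simp)
    -- partners of window vertices are window vertices
    have hπW : ∀ a ∈ W, M.2.partner a ∈ W := by
      intro a ha
      obtain ⟨-, e, he, hae⟩ := mem_filter.1 ha
      refine mem_filter.2 ⟨mem_univ _, e, he, ?_⟩
      -- `e = s(a, partner a)`
      obtain ⟨e', he', hae'⟩ := M.2.exists_mem (mem_univ a)
      have hee' : e = e' := M.2.unique (hEM he) he' hae hae'
      have hmk := M.2.mk_partner_mem a
      have heq : e' = s(a, M.2.partner a) := M.2.unique he' hmk hae' (Sym2.mem_mk_left _ _)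
      rw [hee', heq]; exact Sym2.mem_mk_right _ _
    have hWcard : W.card ≤ 2 * k := by rw [← hEcard]; exact card_window_le M.2 hEM
    -- the junta property of `Gpq p q` on `W`
    have hxxW : ∀ (a : Fin n), a ∈ W → ∀ U U' : Finset (Fin n), U ∩ W = U' ∩ W → xx U a = xx U' a := by
      intro a ha U U' hUU'
      have hmem : ∀ z ∈ W, (z ∈ U ↔ z ∈ U') := fun z hz => by
        constructor
        · intro hzU; have : z ∈ U ∩ W := mem_inter.2 ⟨hzU, hz⟩; rw [hUU'] at this; exact (mem_inter.1 this).1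
        · intro hzU'; have : z ∈ U' ∩ W := mem_inter.2 ⟨hzU', hz⟩; rw [← hUU'] at this; exact (mem_inter.1 this).1
      rw [hxx]; dsimp only
      simp only [hmem a ha, hmem _ (hπW a ha)]
    obtain ⟨P, hPdeg, -, hPval, hPsm⟩ := junta_sum_law_smooth M.2 hEM (t := t) (by rw [hEcard]; omega)
      (by rw [hEcard, hN]; omega) (by rw [hN]; omega) (Gpq p q)
      (fun B => if h : ∃ U : OddSet n, U.1.card = t ∧ U.1 ∩ W = B then Gpq p q h.choose.1 else 0)
      (fun U' _ hU't => by
        have hodd : Odd U'.card := hU't ▸ ht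
        have hex : ∃ U : OddSet n, U.1.card = t ∧ U.1 ∩ W = U' ∩ W := ⟨⟨U', hodd⟩, hU't, rfl⟩
        rw [← hW, dif_pos hex]
        have h2 := hex.choose_spec.2
        have hodd' : Odd hex.choose.1.card := hex.choose.2
        rw [hGpq]; dsimp only
        rw [dif_pos hodd, dif_pos hodd']
        have hJeq : U' ∩ J = hex.choose.1 ∩ J := by
          calc U' ∩ J = (U' ∩ W) ∩ J := by rw [inter_assoc, inter_eq_right.2 hJW]
            _ = (hex.choose.1 ∩ W) ∩ J := by rw [h2]
            _ = hex.choose.1 ∩ J := by rw [inter_assoc, inter_eq_right.2 hJW]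
        rw [hf ⟨U', hodd⟩ ⟨hex.choose.1, hodd'⟩ hJeq, hxxW p hpW U' hex.choose.1 h2.symm, hxxW q hqW U' hex.choose.1 h2.symm])
      (fun B => by
        split_ifs with h
        · rw [hGpq]; dsimp only
          split_ifs
          · refine mul_nonneg (hf0 _) (mul_nonneg ?_ ?_) <;> (rw [hxx]; dsimp only; positivity)
          · exact le_refl _
        · exact le_refl _)
      (Λmax := Λf) (fun B => by
        split_ifs with h
        · rw [hGpq]; dsimp only
          split_ifs
          · have h1 : xx h.choose.1 p * xx h.choose.1 q ≤ 1 := by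
              rw [hxx]; dsimp only; split_ifs <;> norm_num
            have h2 : 0 ≤ xx h.choose.1 p * xx h.choose.1 q := by
              rw [hxx]; dsimp only; positivity
            calc f _ * (xx h.choose.1 p * xx h.choose.1 q) ≤ Λf * 1 := mul_le_mul (hfΛ _) h1 h2 hΛf
              _ = Λf := mul_one _
          · exact hΛf
        · exact hΛf)
    refine ⟨P, by rw [← hEcard]; exact hPdeg, fun c i hci => by rw [← hN]; exact hPval c i hci, fun m ξ hξ0 hξN => ?_⟩
    have h1 := hPsm m ξ hξ0 (by rw [hN]; exact hξN)
    rw [hEcard, hN, ← hW] at h1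
    refine h1.trans ?_
    have h4 : (2 : ℝ) ^ W.card ≤ (4 : ℝ) ^ k := by
      calc (2 : ℝ) ^ W.card ≤ (2 : ℝ) ^ (2 * k) := pow_le_pow_right₀ (by norm_num) hWcard
        _ = (4 : ℝ) ^ k := by rw [pow_mul]; norm_num
    exact mul_le_mul_of_nonneg_right (mul_le_mul_of_nonneg_left h4 hΛf) (by positivity)
  choose Ppq hPpqdeg hPpqval hPpqsm using hpat
  set Pt : Polynomial ℝ := ∑ p, ∑ q, Polynomial.C (v p * v q) * Ppq p q with hPt
  have hPtdeg : Pt.natDegree ≤ k := by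
    refine natDegree_sum_le_of_forall_le _ _ fun p _ => natDegree_sum_le_of_forall_le _ _ fun q _ => ?_
    exact (natDegree_C_mul_le _ _).trans (hPpqdeg p q)
  have hPtval : ∀ c i : ℕ, c + 2 * i = t →
      ∑ U ∈ (univ : Finset (Fin n)).powerset.filter (fun U =>
          (M.1.filter fun e => cutCount U e = 1).card = c ∧ (M.1.filter fun e => cutCount U e = 2).card = i), G U =
        ((N.choose (c + i) * (c + i).choose i * 2 ^ c : ℕ) : ℝ) * Pt.eval (c : ℝ) := by
    intro c i hci
    rw [sum_congr rfl fun U _ => hGsum U, sum_comm, hPt, eval_finsetSum, mul_sum]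
    refine sum_congr rfl fun p _ => ?_
    rw [sum_comm, eval_finsetSum, mul_sum]
    refine sum_congr rfl fun q _ => ?_
    rw [← mul_sum, hPpqval p q c i hci, eval_mul, eval_C]
    ring
  have hPtsm : ∀ (m : ℕ) (ξ : ℝ), 0 ≤ ξ → ξ ≤ (N : ℝ) →
      |(derivative^[m] Pt).eval ξ| ≤ (∑ p, |v p|) ^ 2 * Λf * (4 : ℝ) ^ k *
        (((k.choose m : ℕ) : ℝ) * (m.factorial : ℝ) * (N : ℝ) ^ (k - m) / (N.descFactorial k : ℝ)) := by
    intro m ξ hξ0 hξN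
    set R : ℝ := Λf * (4 : ℝ) ^ k * (((k.choose m : ℕ) : ℝ) * (m.factorial : ℝ) * (N : ℝ) ^ (k - m) / (N.descFactorial k : ℝ)) with hR
    have hR0 : 0 ≤ R := by rw [hR]; positivity
    rw [hPt, iterate_derivative_sum, eval_finsetSum]
    calc |∑ p, (derivative^[m] (∑ q, Polynomial.C (v p * v q) * Ppq p q)).eval ξ|
        ≤ ∑ p, |(derivative^[m] (∑ q, Polynomial.C (v p * v q) * Ppq p q)).eval ξ| := abs_sum_le_sum_abs _ _
      _ ≤ ∑ p, ∑ q, |v p| * |v q| * R := sum_le_sum fun p _ => by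
          rw [iterate_derivative_sum, eval_finsetSum]
          refine (abs_sum_le_sum_abs _ _).trans (sum_le_sum fun q _ => ?_)
          rw [iterate_derivative_C_mul, eval_mul, eval_C, abs_mul, abs_mul]
          exact mul_le_mul_of_nonneg_left (hPpqsm p q m ξ hξ0 hξN) (by positivity)
      _ = (∑ p, |v p|) ^ 2 * R := by rw [sq, sum_mul_sum, sum_mul]; exact sum_congr rfl fun p _ => by rw [sum_mul]
      _ = _ := by rw [hR]; ring
  -- STEP B: the same level sums from the sharp half-degree law, with nonnegative virtual value
  obtain ⟨L, g, hg, hfg⟩ := exists_sos_of_nonneg_junta J f hf hf0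
  have hCvlow : (fun U : OddSet n => Cv U.1) ∈ Submodule.span ℝ (Set.range fun A' : {A' : Finset (Fin n) // A'.card ≤ 2} =>
      fun U : OddSet n => if A'.1 ⊆ U.1 then (1 : ℝ) else 0) := containment_mem_lowSpan M v
  have hlow : ∀ l, (fun U : OddSet n => g l U * Cv U.1) ∈ Submodule.span ℝ (Set.range fun A' : {A' : Finset (Fin n) // A'.card ≤ k} =>
      fun U : OddSet n => if A'.1 ⊆ U.1 then (1 : ℝ) else 0) := fun l => mul_mem_lowSpan (hg l) hCvlow
  have hα' : ∀ l, ∃ cα : {A' : Finset (Fin n) // A'.card ≤ k} → ℝ,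
      ∑ A', cα A' • (fun U : OddSet n => if A'.1 ⊆ U.1 then (1 : ℝ) else 0) = fun U => g l U * Cv U.1 :=
    fun l => (Submodule.mem_span_range_iff_exists_fun ℝ).1 (hlow l)
  choose α hα using hα'
  have hαeval : ∀ (U : OddSet n) l, g l U * Cv U.1 = ∑ A' : {A' : Finset (Fin n) // A'.card ≤ k}, α l A' * (if A'.1 ⊆ U.1 then (1 : ℝ) else 0) := by
    intro U l
    have := congrFun (hα l) U
    rw [Finset.sum_apply] at this
    rw [← this]
    exact sum_congr rfl fun A' _ => by rw [Pi.smul_apply, smul_eq_mul]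
  have hkM : 2 * k ≤ M.1.card := by rw [hN]; omega
  have hr₁ : (k : ℝ) - 1 < (t : ℝ) / 2 := by
    have : (2 : ℝ) * k + 1 ≤ t := by exact_mod_cast hJt
    linarith
  have hr₂ : (t : ℝ) / 2 < (M.1.card : ℝ) - k + 1 := by
    rw [hN]
    have h1 : (2 : ℝ) * k + 1 ≤ t := by exact_mod_cast hJt
    have h2 : (t : ℝ) ≤ N := by exact_mod_cast htN
    linarith
  obtain ⟨Ps, hPsdeg, hPs0, hPsval⟩ := lowdeg_sum_law_sharp Grigoriev2001_knapsackFormNonneg_holds M hkM hr₁ hr₂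
    (fun (_ : Fin 1) (l : Fin L) A' => α l A') (1 : Matrix (Fin 1) (Fin 1) ℝ) Matrix.PosSemidef.one
  have hPsval' : ∀ c i : ℕ, c + 2 * i = t →
      ∑ U ∈ (univ : Finset (Fin n)).powerset.filter (fun U =>
          (M.1.filter fun e => cutCount U e = 1).card = c ∧ (M.1.filter fun e => cutCount U e = 2).card = i), G U =
        ((N.choose (c + i) * (c + i).choose i * 2 ^ c : ℕ) : ℝ) * Ps.eval (c : ℝ) := by
    intro c i hci
    rw [← hN, ← hPsval c i hci]
    refine sum_congr rfl fun U' hU' => ?_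
    have hodd : Odd U'.card := by
      obtain ⟨-, hc, hi⟩ := mem_filter.1 hU'
      have h := card_eq_cr_add_two_mul_in M.2 (subset_univ U')
      rw [hc, hi, hci] at h
      exact h ▸ ht
    rw [hG]; dsimp only
    rw [dif_pos hodd, hfg ⟨U', hodd⟩, sum_mul]
    simp only [Fin.sum_univ_one, Matrix.one_apply_eq, one_mul]
    refine sum_congr rfl fun l _ => ?_
    rw [← hαeval ⟨U', hodd⟩ l]
    ring
  -- STEP C: uniqueness
  have hPtPs : Pt = Ps := levelLaw_unique ht htN hJt _ hPtdeg hPsdeg hPtval hPsval'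
  refine ⟨Pt, hPtdeg, by rw [hPtPs]; exact hPs0, hPtval, hPtsm⟩

end Summit.PneNP.PneNP.Theorems.ChebyshevTracialDesignJuntaTiltedProfile
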